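import Literature.AlgebraicGeometry.ModuliOfAbelianVarieties.SymplecticLiftableOfMarkedFibreCover   -- ★ p849981 zip (`pairingReading_comp_of_similitude`, `levelReading_comp_of_congr`, `mixedWeilClause_of_weilDiv_linEquiv`) + ★ [L1] + ★ (b) `exists_symplecticLift_of_levelReading`
import Literature.AlgebraicGeometry.AbelianSchemes.PolarizationHasTypeOfSymplecticLift                    -- `Polarization.hasType_of_symplecticLift` (the δ-clause from a symplectic lift + ★ constancy)
import HarnessLib

/-!
# `HasType δ` BY THE MARKING ROAD: the type of a polarisation from ONE adelically marked complex fibre (and its transport through a cover)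

Topic `AlgebraicGeometry/ModuliOfAbelianVarieties`; namespace `Literature.AlgebraicGeometry.ModuliOfAbelianVarieties`.  THEOREMS ONLY (no definition, no named fact,
no instance, no notation, no `sorry`).  Cell `hodgecm-mathlib`, FLOOR 0, P6 «MOD programme» (crux hLiu418 = stmt-HodgeConjecture-24832, `--supports`, count-neutral); line L4,
(S8) sheet-line closer, road (γ′) «Serre tensor over `X`, classified», organ **(N3) TYPE-m** (LA4-plan (g2) BOOK v3 2026-09-02T08:48:23Z; consumer: the `hT` binder of ★
`exists_serreTwist_moduliTuple_of_isCMField_rowA`, LA7-p01 (g3)) — the MARKING-ROAD twins of ★ [L1] `isSymplecticLiftable_of_markedComplexFibre` and of the ★ p849981 zip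
`isSymplecticLiftable_of_markedComplexFibre_comp` for the TYPE clause, replacing the dead coprime engine (e).  At a complex point the symplectic lift is BUILT from the
marking `[J, r]` with its level and pairing readings (★ (b) `SiegelAdelicMarking.exists_symplecticLift_of_levelReading`, [Lan2013PELCompactifications] Lemma 1.3.6.5,
[Milne2005ShimuraVarieties] Thm. 6.11 «`η = u ∘ a`») and fed to `Polarization.hasType_of_symplecticLift` ([MumfordFogartyKirwan1994] App. 7A «`ker(λ) ≅ ∏ ℤ∕δᵢ × ∏ μ_{δᵢ}`»);
the zip transports the readings of `(B, m, Θ)` through `c : B → B′`, `u′ = c ∘ u`, by ★ [L2-pair] `pairingReading_comp_of_similitude` and ★ [L2-level] `levelReading_comp_of_congr`.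

* **`SiegelAdelicMarking.hasType_of_markedComplexFibre`** — ONE marked complex fibre with readings ⇒ `pol.HasType δ` over the preconnected base.
* **`SiegelAdelicMarking.hasType_of_markedComplexFibre_comp`** — the zip: readings of `B` + quotient marking of `B′` + the `r′⁻¹r` arithmetic ⇒ `pol′.HasType δ`.
Budgets: default heartbeats.

References: [MumfordFogartyKirwan1994] D. Mumford, J. Fogarty, F. Kirwan, *Geometric Invariant Theory* (3rd ed. 1994), App. 7A pp. 234–235, Ch. 7 §2 Prop. 7.3;
[Lan2013PELCompactifications] K.-W. Lan, *Arithmetic compactifications of PEL-type Shimura varieties* (2013), §1.3.6 Lemma 1.3.6.5, Lemma 1.3.6.6, Cor. 1.3.6.7 (pp. 81–82);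
[MumfordAV1970] D. Mumford, *Abelian Varieties* (1970), §20 pp. 184–186, §23 Thm. 2 p. 231; [Milne2005ShimuraVarieties] J. S. Milne, *Introduction to Shimura varieties* (2005), §6 Thm. 6.11 p. 74, §12 (63) p. 116.
HC_CM is proved only modulo the printed citations (2 remaining named inputs hLiu418 24832, h413 24833) until rung 0 closes — count-neutral.
-/

set_option autoImplicit false

noncomputable section

open CategoryTheory AlgebraicGeometry Matrix NumberField IsDedekindDomain
open Literature.AlgebraicGeometry.Motives (AbelianVariety AlgPoints CartierDivisor)
open Literature.AlgebraicGeometry.AbelianSchemes (AbelianSchemeOver)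

namespace Literature.AlgebraicGeometry.ModuliOfAbelianVarieties

open SiegelModuli
open Literature.NumberTheory.Adeles (latticeOfGL)

/-- **(N3) ONE MARKED COMPLEX FIBRE WITH READINGS ⇒ `HasType δ` OVER THE CONNECTED BASE** — the TYPE twin of ★ [L1] `isSymplecticLiftable_of_markedComplexFibre` (same
readings `hpair`, `hlevel` through `r`): the symplectic lift BUILT from the marking (★ (b) `exists_symplecticLift_of_levelReading`) feeds `hasType_of_symplecticLift`.
[cite: MumfordFogartyKirwan1994, App. 7A (pp. 234–235)] [cite: Lan2013PELCompactifications, §1.3.6 Lemma 1.3.6.5 and Cor. 1.3.6.7 (pp. 81–82)]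
[cite: Milne2005ShimuraVarieties, §6 Thm. 6.11 p. 74 and p. 75] -/
theorem SiegelAdelicMarking.hasType_of_markedComplexFibre {g : ℕ} {δ : Fin g → ℕ} {J : C0pm δ} {r : gspFinAdelic δ}
    {S : Scheme.{0}} [PreconnectedSpace S] {B : AbelianSchemeOver S}
    (hQ : ∀ M : ℕ, M ≠ 0 → ∀ s : S, (M : S.residueField s) ≠ 0)
    {N : ℕ} (φ : B.LevelStructure g N) (hN : N ≠ 0) {D : B.DualPair} (pol : B.Polarization D) (hδ : IsPolarizationType δ)
    {s₀ : Spec (.of ℂ) ⟶ S} (Θ₀ : CartierDivisor (B.fibre s₀).toAbelianVariety.X.left) (hΘ₀ : B.IsLambdaOfAt s₀ D pol.lam Θ₀)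
    (m : SiegelAdelicMarking J r (B.fibre s₀).toAbelianVariety)
    (ζ : ℕ → ℂ) (hζ : ∀ ⦃M : ℕ⦄, N ∣ M → M ≠ 0 → IsPrimitiveRoot (ζ M) M)
    (hζ_pow : ∀ ⦃M : ℕ⦄ (k : ℕ), N ∣ M → M ≠ 0 → k ≠ 0 → ζ (k * M) ^ k = ζ M)
    (hpair : ∀ ⦃M : ℕ⦄, N ∣ M → ∀ (hMΩ : (M : ℂ) ≠ 0) (x y : Fin g ⊕ Fin g → ZMod M)
      (P Q : (B.fibre s₀).toAbelianVariety.torsionPoints ℂ (M : ℤ)),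
      (∀ v, AdelicCongr ((r⁻¹ : gspFinAdelic δ) : GL (Fin g ⊕ Fin g) finAdeleQ) 1 v
          (fun i => ((x i).val : ℚ) / M) → (P : (B.fibre s₀).toAbelianVariety.Points ℂ) = m.r v) →
      (∀ w, AdelicCongr ((r⁻¹ : gspFinAdelic δ) : GL (Fin g ⊕ Fin g) finAdeleQ) 1 w
          (fun i => ((y i).val : ℚ) / M) → (Q : (B.fibre s₀).toAbelianVariety.Points ℂ) = m.r w) →
      haveI := AbelianVariety.isDominant_toSchemeHom_zsmul_of_ne_zero (B.fibre s₀).toAbelianVariety hMΩ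
      (B.fibre s₀).toAbelianVariety.weilPairingLevel Θ₀ P Q = ζ M ^ (AbelianSchemeOver.typeFormMod δ M x y).val)
    (hlevel : ∀ i : Fin g ⊕ Fin g, ∃ v : Fin g ⊕ Fin g → ℚ,
      AdelicCongr ((r⁻¹ : gspFinAdelic δ) : GL (Fin g ⊕ Fin g) finAdeleQ) 1 v
          (fun j => (((Pi.single i (1 : ZMod N) : Fin g ⊕ Fin g → ZMod N) j).val : ℚ) / N) ∧
        B.restrictPt s₀ (φ.σ i) = m.r v) :
    pol.HasType δ := by
  obtain ⟨Λ₀, -, -⟩ := SiegelAdelicMarking.exists_symplecticLift_of_levelReading φ Θ₀ m ζ hζ hζ_pow hpair hlevel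
  exact pol.hasType_of_symplecticLift (fun s M hM => hQ M hM.ne' s) φ hN hδ s₀ hΘ₀ Λ₀

/-- **(N3) ZIP — `HasType δ` OF `pol′` FROM ONE MARKED COMPLEX FIBRE OF `B` AND THE QUOTIENT MARKING OF `B′`** — the TYPE twin of ★ p849981
`isSymplecticLiftable_of_markedComplexFibre_comp` (same binders, plus `hδ`): the readings of `(B, m, Θ)` are transferred through `c : B → B′` with `u′ = c ∘ u` to
`(B′, m′, Θ′)` by ★ [L2-pair] `pairingReading_comp_of_similitude` and ★ [L2-level] `levelReading_comp_of_congr`, then `hasType_of_markedComplexFibre`.  USE ((γ′)): `B′ :=`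
the Serre tensor family `B ⊗ 𝔞⁻¹` over a component of `X`, `c := ψ_P`, `m′` from ★ `exists_serreTensor_cover_marked_of_reading`, `(hT, hμ, ε, hk)` from ★
`UnitaryCurveAuxiliaryTorusLegLattice` §8 — EXACTLY the inputs the `hsymp` binder already eats.
[cite: Lan2013PELCompactifications, §1.3.6 Lemma 1.3.6.5 (p. 81), Lemma 1.3.6.6 and Cor. 1.3.6.7 (pp. 81–82)] [cite: MumfordFogartyKirwan1994, App. 7A (pp. 234–235)]
[cite: MumfordAV1970, §20 (properties (1)–(3) of e_n, pp. 184–186) and §23 (Thm. 2, p. 231)] -/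
theorem SiegelAdelicMarking.hasType_of_markedComplexFibre_comp {g : ℕ} {δ : Fin g → ℕ}
    {J J' : C0pm δ} {r' r : gspFinAdelic δ}
    {S : Scheme.{0}} [PreconnectedSpace S] {B B' : AbelianSchemeOver S}
    (hQ : ∀ M : ℕ, M ≠ 0 → ∀ s : S, (M : S.residueField s) ≠ 0)
    {N : ℕ} (hN : N ≠ 0) (φ : B.LevelStructure g N) (φ' : B'.LevelStructure g N)
    (c : B.X ⟶ B'.X) [IsMonHom c] (hφ' : ∀ i, φ'.σ i = φ.σ i ≫ c)
    {D' : B'.DualPair} (pol' : B'.Polarization D') (hδ : IsPolarizationType δ) {s₀ : Spec (.of ℂ) ⟶ S}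
    [IsDominant (AbelianVariety.Hom.toSchemeHom (AbelianSchemeOver.fibreHom c s₀))]
    (Θ : CartierDivisor (B.fibre s₀).toAbelianVariety.X.left) (Θ' : CartierDivisor (B'.fibre s₀).toAbelianVariety.X.left)
    (hΘ' : B'.IsLambdaOfAt s₀ D' pol'.lam Θ') {ν : ℕ} (hν : ν ≠ 0)
    (hdiv : ∀ Q : (B.fibre s₀).toAbelianVariety.Points ℂ,
      ((B.fibre s₀).toAbelianVariety.weilDiv (Θ'.pullback (AbelianVariety.Hom.toSchemeHom (AbelianSchemeOver.fibreHom c s₀))) Q).LinEquiv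
        (ν • (B.fibre s₀).toAbelianVariety.weilDiv Θ Q))
    (m : SiegelAdelicMarking J r' (B.fibre s₀).toAbelianVariety) (m' : SiegelAdelicMarking J' r (B'.fibre s₀).toAbelianVariety)
    (hm' : ∀ v, m'.r v = AlgPoints.map (AbelianSchemeOver.fibreHom c s₀).hom.hom.hom (m.r v))
    (hT : ∀ i j, (ν : finAdeleQ) *
      (((r'⁻¹ * r : gspFinAdelic δ) : GL (Fin g ⊕ Fin g) finAdeleQ) : Matrix (Fin g ⊕ Fin g) (Fin g ⊕ Fin g) finAdeleQ) i j ∈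
        FiniteAdeleRing.integralAdeles (𝓞 ℚ) ℚ)
    {μ : finAdeleQˣ} (hμ : IsMultiplier (typeFormOver δ finAdeleQ) ((r'⁻¹ * r : gspFinAdelic δ) : GL (Fin g ⊕ Fin g) finAdeleQ) μ)
    (ε : (FiniteAdeleRing.integralAdeles (𝓞 ℚ) ℚ)ˣ)
    (hε : ((ε : FiniteAdeleRing.integralAdeles (𝓞 ℚ) ℚ) : finAdeleQ) = (ν : finAdeleQ) * (μ : finAdeleQ))
    (hk : ∀ i j, ∃ t ∈ FiniteAdeleRing.integralAdeles (𝓞 ℚ) ℚ,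
      ((((r⁻¹ * r' : gspFinAdelic δ) : GL (Fin g ⊕ Fin g) finAdeleQ) : Matrix (Fin g ⊕ Fin g) (Fin g ⊕ Fin g) finAdeleQ) - 1) i j =
        (N : finAdeleQ) * t)
    (ζ : ℕ → ℂ) (hζ : ∀ ⦃M : ℕ⦄, N ∣ M → M ≠ 0 → IsPrimitiveRoot (ζ M) M)
    (hζ_pow : ∀ ⦃M : ℕ⦄ (k : ℕ), N ∣ M → M ≠ 0 → k ≠ 0 → ζ (k * M) ^ k = ζ M)
    (hpair : ∀ ⦃M : ℕ⦄, N ∣ M → ∀ (hMΩ : (M : ℂ) ≠ 0) (x y : Fin g ⊕ Fin g → ZMod M)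
      (P Q : (B.fibre s₀).toAbelianVariety.torsionPoints ℂ (M : ℤ)),
      (∀ v, AdelicCongr ((r'⁻¹ : gspFinAdelic δ) : GL (Fin g ⊕ Fin g) finAdeleQ) 1 v
          (fun i => ((x i).val : ℚ) / M) → (P : (B.fibre s₀).toAbelianVariety.Points ℂ) = m.r v) →
      (∀ w, AdelicCongr ((r'⁻¹ : gspFinAdelic δ) : GL (Fin g ⊕ Fin g) finAdeleQ) 1 w
          (fun i => ((y i).val : ℚ) / M) → (Q : (B.fibre s₀).toAbelianVariety.Points ℂ) = m.r w) →
      haveI := AbelianVariety.isDominant_toSchemeHom_zsmul_of_ne_zero (B.fibre s₀).toAbelianVariety hMΩ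
      (B.fibre s₀).toAbelianVariety.weilPairingLevel Θ P Q = ζ M ^ (AbelianSchemeOver.typeFormMod δ M x y).val)
    (hlevel : ∀ i : Fin g ⊕ Fin g, ∃ v : Fin g ⊕ Fin g → ℚ,
      AdelicCongr ((r'⁻¹ : gspFinAdelic δ) : GL (Fin g ⊕ Fin g) finAdeleQ) 1 v
          (fun j => (((Pi.single i (1 : ZMod N) : Fin g ⊕ Fin g → ZMod N) j).val : ℚ) / N) ∧
        B.restrictPt s₀ (φ.σ i) = m.r v) :
    pol'.HasType δ := by
  obtain ⟨ζ', hζ', hζ'_pow, hpair'⟩ := SiegelAdelicMarking.pairingReading_comp_of_similitude c m m' hm' hν hT hμ ε hε Θ Θ' ζ hζ hζ_pow hpair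
    (AbelianSchemeOver.mixedWeilClause_of_weilDiv_linEquiv c hν Θ Θ' hdiv N)
  exact SiegelAdelicMarking.hasType_of_markedComplexFibre hQ φ' hN pol' hδ Θ' hΘ' m' ζ' hζ' hζ'_pow hpair'
    (SiegelAdelicMarking.levelReading_comp_of_congr c m m' hm' φ φ' hφ' hk hlevel)

end Literature.AlgebraicGeometry.ModuliOfAbelianVarieties

end
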